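import Summits.BirchSwinnertonDyer.BirchSwinnertonDyer.Theorems.RamifiedHeegnerPairLeafRankOneUpperAtThreeLeafTwistStable
import Summits.BirchSwinnertonDyer.Rank1Residual.X11b.CastellaErratumTwistUnits
import Summits.BirchSwinnertonDyer.Rank1Residual.X11b.BDPRouteRTDegreeTelescope
import Summits.BirchSwinnertonDyer.Rank1Residual.Additive.QuadraticTwistBSDComparison
import HarnessLib

/-!
# Route `RamifiedHeegnerPair`, crux U₁ `LeafRankOneUpperAtThree` (stmt-BirchSwinnertonDyer-26022), line `splitkolyvagin` —
# the INERT-CARRIER (Shimura-curve) road, part 1: tools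

HONEST FRAMING. Theorems only; helper file (`--supports stmt-BirchSwinnertonDyer-26022 --as helper`); nothing is booked, no item
is closed, BSD is not proved for any curve; CONDITIONAL on every displayed input. Lead prover bsd-line-rhp-p2 g10, 2026-08-28.

THE OBSERVATION (new for the leaf; the mechanism is team x11b3's Shimura road for class X11b at `p = 3`,
`Summits/…/X11b/Three/UpperHalfShimuraCore.lean`, `Theorems/ClassRecordThreeShimuraUpperHalf.lean`). U₁'s research residue Σ★‴
(skeleton v8) is the Σ-form (Tamagawa-exact) `3`-divisibility of derived Heegner points on the MULTI-CARRIER rows: over a Heegner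
field in which every prime of `N_E` SPLITS, Kolyvagin's bound `ord₃ #Ш(E/K) ≤ 2·ord₃[E(K):ℤy_K]` misses BSD₃ by `2·Σ_q ord₃ c_q(E)`.
Choose instead a field of Jetchev–Skinner–Wan type (§7.4.2): the split-multiplicative carriers `q` (`3 ∣ c_q = ord_q Δ_min`) INERT,
every other bad prime (in particular the additive `3`) split. Then the Heegner point lives on the Shimura curve `X_{N⁺,N⁻}`
(`N⁻ = ∏ S`), and in the Gross–Zagier/BSD bookkeeping the Tamagawa numbers at the inert carriers are CANCELLED by the
Ribet–Takahashi degree drop `δ(N,1)/δ(N⁺,N⁻) ≐ ∏_{q∣N⁻} ord_q Δ_min` (Pasten 2024 §6, at the non-Eisenstein prime `3`): no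
divisibility of Kolyvagin classes is needed on those rows. The additive prime `3` never enters `N⁻` and the typed Shimura-curve
fact (`shimuraCurve_heegnerPoint_grossZagier_kolyvagin`: CST14 Thm. 1.5 + JSW17 Thm. 4.4.1, `p` odd, `E[p]` irreducible, `p` split,
no reduction condition at `p`) applies verbatim at `p = 3 ∣ N⁺`.

This file supplies the leaf-side tools the road needs (part 2 is `…LeafRankOneUpperAtThreeShimuraInert.lean`):

* §1 `subGord_twist_of_split_three`, `leaf_twist_of_split_three` — the leaf Gss2 at `3` is stable under twisting by the (odd)
  discriminant of ANY imaginary quadratic field in which `3` splits (p610563's `leaf_twist_of_heegner` asked the Heegner hypothesis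
  for the whole conductor; only its consequence «`3` splits» is used). Needed because the JSW field is NOT Heegner for `N_E`.
* §2 `twistLowerShape_of_missingLowerBoundAt_rankZero` — the partner's lower half `Typed.MissingLowerBoundAt Wd 3` (rank `0`) in the
  `L(E^d,1)/Ω` currency consumed by x11b3's bookkeeping core `X11b.missingUpperBoundAt_of_shimuraShapes`.
* §3 `padicValNat_delta_empty_eq_of_pair_coker` — the degree identity (DEG) `ord₃ δ(N,1) = ord₃ δ(N⁺,N⁻) + Σ_{q∈S} ord₃ ord_qΔ` for a
  TWO-element inert set `S = {q₁, q₂}` from the Papikian–Rabinoff cokernel bound at ONE odd `q₂ ≢ 1 (mod 3)` (Pasten Lemma 6.18);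
  the (ram)-witness forms are multr1-p2's `RTDegree.padicValNat_delta_empty_eq_of_witness{,_mem}`.

References: [cite: JetchevSkinnerWan2017, §7.4.2 (p. 31), Thm. 4.4.1 (p. 19)] [cite: PastenShimura2024, Prop. 6.13, Lemma 6.18, §6.9]
[cite: PapikianRabinoff2016, Cor. 3.5] [cite: SilvermanATAEC1994, IV.9.4 (PDF pp. 344–346)] [cite: Knapp1993, Prop. 12.10]
[cite: Miller2011LMS, Def. 1.1].
-/

-- D-0017: single-problem summit, so `Summit.BirchSwinnertonDyer.BirchSwinnertonDyer.…` repeats a namespace BY DESIGN.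
set_option linter.dupNamespace false
set_option autoImplicit false

noncomputable section

open scoped Classical NumberField

open WeierstrassCurve IsDedekindDomain IsDedekindDomain.HeightOneSpectrum NumberField
  Rat.HeightOneSpectrum Literature.NumberTheory.EllipticCurves
  Literature.NumberTheory.EllipticCurves.ModularForms
  Literature.NumberTheory.EllipticCurves.Rank1Residual
  Literature.NumberTheory.EllipticCurves.Rank1Residual.Typed
  Literature.NumberTheory.QuadraticFields
  Summit.BirchSwinnertonDyer.Rank1Residual
  Summit.BirchSwinnertonDyer.Rank1Residual.Additive
  Summit.BirchSwinnertonDyer.BirchSwinnertonDyer.Theses.RamifiedHeegnerPair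
  Summit.BirchSwinnertonDyer.BirchSwinnertonDyer.Theorems
  Summit.BirchSwinnertonDyer.BirchSwinnertonDyer.Theorems.SchneiderFree

namespace Summit.BirchSwinnertonDyer.BirchSwinnertonDyer.Theorems.LeafShimuraInert

/-! ## §1 The leaf is stable under twisting by an odd discriminant in which `3` splits -/

/-- **Cell `(G)` at `3` is stable under twisting by the odd discriminant of an imaginary quadratic field in which `3` SPLITS**:
for `W` globally minimal, additive at `3` with `SubGord W 3`, `K` imaginary quadratic of odd discriminant with
`SatisfiesHeegnerHypothesis 3 K` (i.e. `3` splits), and a globally minimal `Wd = Cd • E^{(d_K)}`: `Addv Wd 3 ∧ SubGord Wd 3 ∧ j(Wd) = j(E)`.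
p610563's `subGord_twist_of_heegner` with the Heegner hypothesis for `N_E` replaced by its only consequence used, «`3` splits».
-- adapted from Summits/BirchSwinnertonDyer/BirchSwinnertonDyer/Theorems/RamifiedHeegnerPairLeafRankOneUpperAtThreeLeafTwistStable.lean
[folklore] [cite: SilvermanATAEC1994, IV.9.4 (PDF pp. 344–346)] -/
theorem subGord_twist_of_split_three (W : WeierstrassCurve ℚ) [W.IsElliptic] [W.IsGloballyMinimal]
    (hadd : Addv W 3) (hG : SubGord W 3)
    (K : Type) [Field K] [NumberField K] (hK : IsImaginaryQuadratic K)
    (h3 : SatisfiesHeegnerHypothesis 3 K) (hodd : Odd (NumberField.discr K))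
    (Wd : WeierstrassCurve ℚ) [Wd.IsElliptic] [Wd.IsGloballyMinimal] (Cd : VariableChange ℚ)
    (hWd : Cd • W.quadraticTwist (NumberField.discr K : ℚ) = Wd) :
    Addv Wd 3 ∧ SubGord Wd 3 ∧ Wd.j = W.j := by
  have hp : (3 : ℕ).Prime := Fact.out
  have hD0 : (NumberField.discr K : ℚ) ≠ 0 := by exact_mod_cast NumberField.discr_ne_zero K
  have hsq' : IsSquare (algebraMap ℚ ℚ_[3] (NumberField.discr K : ℚ)) :=
    X11b.isSquare_discr_padic_of_heegner K hK h3 3 (dvd_refl 3)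
  have hsq : IsSquare (((NumberField.discr K : ℚ) : ℚ) : ℚ_[3]) := by simpa using hsq'
  have hj : Wd.j = W.j := AdditivePotMult.j_of_model_twist (W := W) hD0 ⟨Cd, hWd⟩
  have haddv : Addv Wd 3 := (AdditivePotMult.addv_iff_of_twist (W := W) hD0 hsq Wd hWd).mpr hadd
  -- `3 ∤ d_K` (split primes are unramified) and `d_K ≡ 1 (mod 4)` (odd discriminant)
  have hpd : ¬ ((3 : ℕ) : ℤ) ∣ NumberField.discr K :=
    Literature.SatisfiesHeegnerHypothesis.not_dvd_discr hK.1 h3 hp (dvd_refl 3)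
  have hd4 : NumberField.discr K % 4 = 1 := Quadratic.discr_emod_four_eq_one hK.1 hodd
  -- the conductor exponent at `3` is unchanged
  have hf : condExp Wd 3 = condExp W 3 := by
    unfold condExp
    refine conductorExponent_eq_of_model_twist_of_not_dvd W Wd hd4 Cd hWd (placeOf 3) ?_
    rw [natGenerator_placeOf_eq]
    exact hpd
  -- the discriminant valuation at `3` is unchanged (`3` splits: the twisted minimal model differs by a `3`-unit)
  have hs3 : X11b.SplitsIn K 3 := h3 3 hp (dvd_refl 3)
  have hu : padicValRat 3 (Cd.u : ℚ) = 0 :=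
    X11b.padicValRat_u_eq_zero_of_twist_minimal_of_splitsIn W 3 K hK.1 hs3 Cd hWd
  have hΔ : padicValRat 3 Wd.Δ = padicValRat 3 W.Δ := by
    haveI := W.isElliptic_quadraticTwist hD0
    have hu0 : ((Cd.u⁻¹ : ℚˣ) : ℚ) ≠ 0 := (Cd.u⁻¹).ne_zero
    have hΔ0 : W.Δ ≠ 0 := W.isUnit_Δ.ne_zero
    have hd6 : (NumberField.discr K : ℚ) ^ 6 ≠ 0 := pow_ne_zero 6 hD0
    have hdv : padicValRat 3 (NumberField.discr K : ℚ) = 0 := by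
      rw [padicValRat.of_int, padicValInt.eq_zero_of_not_dvd hpd, Nat.cast_zero]
    have huv : padicValRat 3 ((Cd.u⁻¹ : ℚˣ) : ℚ) = 0 := by
      rw [Units.val_inv_eq_inv_val, padicValRat.inv, hu, neg_zero]
    rw [← hWd, variableChange_Δ, quadraticTwist_Δ, padicValRat.mul (pow_ne_zero 12 hu0)
      (mul_ne_zero hd6 hΔ0), padicValRat.mul hd6 hΔ0, padicValRat.pow, padicValRat.pow, huv, hdv]
    ring
  refine ⟨haddv, ⟨?_, ?_, ?_⟩, hj⟩
  · -- not potentially multiplicative: `ord₃ j(Wd) = ord₃ j(W) ≥ 0`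
    unfold PotMult; rw [hj]; exact hG.1
  · -- tame: `f₃(Wd) = f₃(W) = 2`
    unfold CondExpTwo; rw [hf]; exact hG.2.1
  · -- `e(Wd) = e(W) ∣ 2`
    rw [semistabilityIndex_dvd_iff Wd 3, ← twelve_dvd_padicValRat_Δ_iff Wd 3, hΔ,
      twelve_dvd_padicValRat_Δ_iff W 3, ← semistabilityIndex_dvd_iff W 3]
    exact hG.2.2

/-- **The W-ALL leaf Gss2 at `3` is stable under twisting by an odd imaginary quadratic discriminant in which `3` splits.** For
`W/ℚ` globally minimal, NON-CM, additive of cell `(G) ∧ ss` at `3` (`Addv W 3`, `SubGss W 3`), `K` imaginary quadratic of ODD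
discriminant with `3` split in `K` (`SatisfiesHeegnerHypothesis 3 K`), and any globally minimal model `Wd = Cd • E^{(d_K)}`: `Wd` is
non-CM, additive of cell `(G) ∧ ss` at `3`, with `j(Wd) = j(E)`. p610563's `leaf_twist_of_heegner` with the Heegner hypothesis for `N_E`
weakened to «`3` splits» — the form needed at a Jetchev–Skinner–Wan field (carriers INERT, `3` split).
-- adapted from Summits/BirchSwinnertonDyer/BirchSwinnertonDyer/Theorems/RamifiedHeegnerPairLeafRankOneUpperAtThreeLeafTwistStable.lean
[cite: Delbourgo1998, §1.5 (G)] [cite: Knapp1993, Prop. 12.10] [cite: SilvermanATAEC1994, IV.9.4 (PDF pp. 344–346)] -/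
theorem leaf_twist_of_split_three (W : WeierstrassCurve ℚ) [W.IsElliptic] [W.IsGloballyMinimal]
    (hCM : ¬ W.HasCM) (hadd : Addv W 3) (hsub : SubGss W 3)
    (K : Type) [Field K] [NumberField K] (hK : IsImaginaryQuadratic K)
    (h3 : SatisfiesHeegnerHypothesis 3 K) (hodd : Odd (NumberField.discr K))
    (Wd : WeierstrassCurve ℚ) [Wd.IsElliptic] [Wd.IsGloballyMinimal] (Cd : VariableChange ℚ)
    (hWd : Cd • W.quadraticTwist (NumberField.discr K : ℚ) = Wd) :
    ¬ Wd.HasCM ∧ Addv Wd 3 ∧ SubGss Wd 3 ∧ Wd.j = W.j := by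
  have hD0 : (NumberField.discr K : ℚ) ≠ 0 := by exact_mod_cast NumberField.discr_ne_zero K
  have hsq' : IsSquare (algebraMap ℚ ℚ_[3] (NumberField.discr K : ℚ)) :=
    X11b.isSquare_discr_padic_of_heegner K hK h3 3 (dvd_refl 3)
  have hsq : IsSquare (((NumberField.discr K : ℚ) : ℚ) : ℚ_[3]) := by simpa using hsq'
  have hCMd : ¬ Wd.HasCM := RamifiedPairUpperBound.not_hasCM_of_smul_quadraticTwist_eq hD0 hWd hCM
  obtain ⟨haddv, hGd, hj⟩ := subGord_twist_of_split_three W hadd hsub.1 K hK h3 hodd Wd Cd hWd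
  -- the minimal `χ₋₃`-twists `V` of `W` (good supersingular at `3`) and `Vd` of `Wd`
  haveI hE3 : (W.quadraticTwist (-3)).IsElliptic := W.isElliptic_quadraticTwist (by norm_num)
  obtain ⟨Cv, hCv⟩ := hasGlobalMinimalModel_rat_holds (W.quadraticTwist (-3))
  haveI : (Cv • W.quadraticTwist (-3)).IsGloballyMinimal := hCv
  have hssV : GoodSS (Cv • W.quadraticTwist (-3)) 3 :=
    ((O5.subGss_three_iff_subGord_and_goodSS_twist W hadd (Cv • W.quadraticTwist (-3)) Cv rfl).mp hsub).2
  haveI hEd3 : (Wd.quadraticTwist (-3)).IsElliptic := Wd.isElliptic_quadraticTwist (by norm_num)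
  obtain ⟨Cw, hCw⟩ := hasGlobalMinimalModel_rat_holds (Wd.quadraticTwist (-3))
  haveI : (Cw • Wd.quadraticTwist (-3)).IsGloballyMinimal := hCw
  -- `Vd` is a `ℚ`-model of `V^{(d_K)}`
  obtain ⟨C, hC⟩ := RamifiedPairUpperBound.exists_smul_twist_of_minusThree_twists W (NumberField.discr K : ℚ) Wd
    (Cv • W.quadraticTwist (-3)) (Cw • Wd.quadraticTwist (-3)) Cd Cv Cw hWd rfl rfl
  -- good at `3` (a `3`-adic-square twist) with the same `a₃` (`3` split in `K`)
  have hgoodVd : (Cw • Wd.quadraticTwist (-3)).HasGoodReductionAtPrime 3 :=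
    (AdditivePotMult.good_iff_of_twist (W := Cv • W.quadraticTwist (-3)) hD0 hsq
      (Cw • Wd.quadraticTwist (-3)) hC).mpr hssV.1
  have haVd : (Cw • Wd.quadraticTwist (-3)).frobeniusTrace 3 = (Cv • W.quadraticTwist (-3)).frobeniusTrace 3 :=
    CastellaGrossiLeeSkinner2022.frobeniusTrace_eq_of_split_twist (W := Cv • W.quadraticTwist (-3)) (p := 3)
      (by norm_num) hssV.1 K hK hodd h3 (Cw • Wd.quadraticTwist (-3)) ⟨C⁻¹, by rw [← hC, inv_smul_smul]⟩
  have hssVd : GoodSS (Cw • Wd.quadraticTwist (-3)) 3 := ⟨hgoodVd, by rw [haVd]; exact hssV.2⟩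
  have hsubd : SubGss Wd 3 :=
    (O5.subGss_three_iff_subGord_and_goodSS_twist Wd haddv (Cw • Wd.quadraticTwist (-3)) Cw rfl).mpr
      ⟨hGd, hssVd⟩
  exact ⟨hCMd, haddv, hsubd, hj⟩

/-! ## §2 The partner's lower half in the `L(E^d,1)/Ω` currency -/

/-- **The rank-zero partner's LOWER half in x11b3's currency.** For `Wd/ℚ` elliptic of analytic rank `0` with
`Typed.MissingLowerBoundAt Wd p` (`#Ш_an(Wd) = q`, `ord_p q ≤ ord_p #Ш(Wd)`) and a rational value `qd = L(Wd,1)/Ω_{Wd}` (`≠ 0`):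
`ord_p qd ≤ ord_p #Ш(Wd) + ord_p ∏c(Wd) − 2·ord_p #Wd(ℚ)_tors` — the hypothesis `htw` of `X11b.missingUpperBoundAt_of_shimuraShapes`
(there discharged by Skinner 2016 Thm. C for a multiplicative partner; here it will be the route member L₀ for a LEAF partner).
Bookkeeping: `#Ш_an = L(1)·t²/(Ω·∏c)` in rank `0` (GZK: `Reg = 1`). [cite: Miller2011LMS, Def. 1.1] -/
theorem twistLowerShape_of_missingLowerBoundAt_rankZero (hGZK : rank_eq_analyticRank_of_analyticRank_le_one)
    (Wd : WeierstrassCurve ℚ) [Wd.IsElliptic] {p : ℕ} [Fact p.Prime] (hr : Wd.analyticRank = 0)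
    {qd : ℚ} (hqd0 : qd ≠ 0) (hqd : Wd.entireLFunction 1 / (Wd.realPeriodRat : ℂ) = (qd : ℂ))
    (hL : Typed.MissingLowerBoundAt Wd p) :
    ∃ q : ℚ, Wd.entireLFunction 1 / (Wd.realPeriodRat : ℂ) = (q : ℂ) ∧
      padicValRat p q ≤ (padicValNat p Wd.shaOrder : ℤ) + padicValNat p Wd.tamagawaProduct -
        2 * padicValNat p Wd.torsionOrder := by
  obtain ⟨q', hq', hle⟩ := hL
  have hΩ : (Wd.realPeriodRat : ℂ) ≠ 0 := by exact_mod_cast Wd.realPeriodRat_pos_holds.ne'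
  have hs : Wd.entireLFunction 1 = (qd : ℂ) * (Wd.realPeriodRat : ℂ) := by
    rw [← hqd, div_mul_cancel₀ _ hΩ]
  have hsha := Additive.TwistComparison.shaAn_eq_ratCast_of_rankZero (W := Wd) hGZK hr hs
  have hqq : q' = qd * (Wd.torsionOrder : ℚ) ^ 2 / (Wd.tamagawaProduct : ℚ) := by
    have : ((q' : ℚ) : ℂ) = ((qd * (Wd.torsionOrder : ℚ) ^ 2 / (Wd.tamagawaProduct : ℚ) : ℚ) : ℂ) := by
      rw [← hq', hsha]
    exact_mod_cast this
  have hv := Additive.TwistComparison.padicValRat_shaAnRat_of_rankZero (W := Wd) (p := p) hqd0 Wd.torsionOrder_pos_holds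
    Wd.tamagawaProduct_pos_holds
  refine ⟨qd, hqd, ?_⟩
  rw [hqq, hv] at hle
  omega

/-! ## §3 (DEG) for a two-element inert set from ONE Papikian–Rabinoff cokernel -/

section Telescope

open Finset

variable {ℓ : ℕ} [Fact ℓ.Prime]
variable {Mult : Finset ℕ} {δ : Finset ℕ → ℕ} {cA ι κ : Finset ℕ → ℕ → ℕ} {c : ℕ → ℕ}

/-- **(DEG) for `S = {q₁, q₂}` from the cokernel bound at ONE odd prime `q₂ ≢ 1 (mod ℓ)`.** With Pasten's shapes (P613), (Pij),
(P68)@`ℓ`, (PEis)@`ℓ` of the Ribet–Takahashi package over the multiplicative primes `Mult` and (P618) «`j_q(D) ∣ q − 1` for odd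
`q ∈ D`» (Lemma 6.18, Papikian–Rabinoff Cor. 3.5): if `q₁ ≠ q₂ ∈ Mult`, `q₂ ≠ 2` and `ℓ ∤ q₂ − 1`, then
`ord_ℓ δ(∅) = ord_ℓ δ({q₁,q₂}) + ord_ℓ c_{q₁} + ord_ℓ c_{q₂}` — ONE telescoping step from `d = ∅` with the cokernel taken at `q₂`.
At `ℓ = 3` this serves every pair of carriers one of which is an odd prime `≡ 2 (mod 3)`; no (ram) witness is needed.
[cite: PastenShimura2024, Prop. 6.13 (p. 23), Lemma 6.18 (p. 24), §6.9 (p. 25)] [cite: PapikianRabinoff2016, Cor. 3.5] -/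
theorem padicValNat_delta_empty_eq_of_pair_coker
    (h613 : ∀ ⦃d : Finset ℕ⦄, d ⊆ Mult → Even d.card → ∀ ⦃q r : ℕ⦄, q ∈ Mult → r ∈ Mult →
      q ∉ d → r ∉ d → q ≠ r →
      δ d * ι d q ^ 2 * κ (insert q (insert r d)) r ^ 2 =
        δ (insert q (insert r d)) * cA d q * cA (insert q (insert r d)) r)
    (hδ : ∀ D, 0 < δ D) (hcA : ∀ D q, 0 < cA D q)
    (hij : ∀ ⦃D : Finset ℕ⦄, D ⊆ Mult → ∀ ⦃q : ℕ⦄, q ∈ Mult → ι D q * κ D q = cA D q)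
    (hvA : ∀ ⦃D : Finset ℕ⦄, D ⊆ Mult → ∀ ⦃q : ℕ⦄, q ∈ Mult →
      padicValNat ℓ (cA D q) = padicValNat ℓ (c q))
    (hι : ∀ ⦃d : Finset ℕ⦄, d ⊆ Mult → ∀ ⦃q : ℕ⦄, q ∈ Mult → q ∉ d → padicValNat ℓ (ι d q) = 0)
    (h618 : ∀ ⦃D : Finset ℕ⦄, D ⊆ Mult → Even D.card → ∀ ⦃q : ℕ⦄, q ∈ D → q ≠ 2 → κ D q ∣ q - 1)
    {q₁ q₂ : ℕ} (hq₁ : q₁ ∈ Mult) (hq₂ : q₂ ∈ Mult) (hne : q₁ ≠ q₂) (hq₂2 : q₂ ≠ 2)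
    (hq₂1 : ¬ ℓ ∣ q₂ - 1) :
    padicValNat ℓ (δ ∅) =
      padicValNat ℓ (δ (insert q₁ (insert q₂ ∅))) + ∑ x ∈ insert q₁ (insert q₂ ∅), padicValNat ℓ (c x) := by
  have hS : insert q₁ (insert q₂ (∅ : Finset ℕ)) ⊆ Mult := by
    intro x hx
    rcases Finset.mem_insert.mp hx with rfl | hx
    · exact hq₁
    · rcases Finset.mem_insert.mp hx with rfl | hx
      · exact hq₂
      · simp at hx
  have hSe : Even (insert q₁ (insert q₂ (∅ : Finset ℕ))).card := by
    rw [Finset.card_insert_of_notMem (by simp [hne]), Finset.card_insert_of_notMem (by simp)]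
    decide
  have hκ : padicValNat ℓ (κ (insert q₁ (insert q₂ ∅)) q₂) = 0 := by
    apply padicValNat.eq_zero_of_not_dvd
    intro hdvd
    exact hq₂1 (dvd_trans hdvd (h618 hS hSe (by simp) hq₂2))
  have h := X11b.RTDegree.padicValNat_delta_empty_step (c := c) h613 hδ hcA hij hvA hι
    (Finset.empty_subset Mult) (by simp) hq₁ hq₂ (by simp) (by simp) hne hκ (by simp)
  exact h

end Telescope

end Summit.BirchSwinnertonDyer.BirchSwinnertonDyer.Theorems.LeafShimuraInert

end
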